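import Mathlib
import HarnessLib
import Summits.Ventures.LatticeQCDFlow.Scaling.AutoregressiveGaugeStepKLLogFloor
import Summits.Ventures.LatticeQCDFlow.Scaling.AutoregressiveGaugeKLExtensiveStepKL
import Summits.Ventures.LatticeQCDFlow.Scaling.AutoregressiveGaugePlaquetteBallMass

/-!
# LatticeQCDFlow / Scaling — THE VOLUME LAW WITH A LOGARITHMICALLY DIVERGENT RATE: in every generation
# order of all links, an endpoint-blind autoregressive gauge model has training loss
# `≥ (d·#sites/4)·(π_β{U_p ∈ B}·log(1/Haar B) − log 2)` for EVERY measurable `B ⊆ G`, and drives an exact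
# sampler with `τ_int(sign) ≥ exp((d·#sites/4)·(π_β{U_p ∈ B}·log(1/Haar B) − log 2)) − ½` — every compact
# group, every dimension, every volume, every coupling

HONEST FRAMING: exact (Metropolis-corrected) sampling algorithms for lattice gauge theory;
figures of merit are autocorrelation/cost numbers at stated couplings and volumes; no
continuum-physics claim.

Venture `LatticeQCDFlow` (cell pub-lqcd), topic `Scaling`, FANOUT row 30 (lean-1, GEN-21) — OUR WORK on
THEORY-2.md §4 row C5: the LOGARITHMIC INSTANCE of `Scaling/AutoregressiveGaugeKLExtensiveStepKL` (the
volume law from any per-link divergence floor `m`) with the floor of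
`Scaling/AutoregressiveGaugeStepKLLogFloor.wilson_stepKL_ge_ballMass_mul_log`: a conditioner for a link
`e` blind to the other links at one endpoint of `e`, with the other three links of a plaquette `p ∋ e` in
its context, has step loss `κ_e ≥ π_β{U_p ∈ B}·log(1/Haar B) − log 2` for every measurable `B ⊆ G` of
positive Haar mass.  With `B = B_ε = {‖ρ(g) − 1‖ ≤ ε}` and Chebyshev on a plaquette floor `w`
(`Scaling/AutoregressiveGaugePlaquetteBallMass.wilson_ball_mass_ge_of_floor`): `π_β(B_ε) ≥
1 − 2N(1 − w)/ε²`, so the rate is `≥ (1 − 2N(1 − w)/ε²)·log(1/φ_ρ(ε)) − log 2` — at weak coupling (`w → 1`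
uniformly in the volume) it exceeds any constant: the per-link rates `½` (plaquette mean) and `2` (small ball)
of the sibling instances are the first two rungs of an unbounded ladder.

## What is proved (all [ours]; continuous `ρ`, `L ≥ 2`, `d ≥ 2`, any real `β`; `B ⊆ G` measurable with
`Haar(B) > 0`; squeezed normalised conditionals `q_a` not reading later links of the duplicate-free order
`l` of ALL links, each `q_e` blind to the other links at an endpoint `Y e` of `e`; `m ≥ 0`)

* §1 **`wilson_kl_arHybrid_ge_dim_mul_card_site_mul_ballLog`** —
  `m ≤ log(1/Haar B)·(1/Z)∫𝟙_B(U_p)F dπ − log 2` for every plaquette `p` ⇒ `(d·#sites/4)·m ≤ KL(e^{−βS_W}/Z ‖ H_l)`;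
  **`wilson_tauInt_sign_ge_exp_ballLog`**, **`wilson_invKish_ge_exp_ballLog`** —
  `exp((d·#sites/4)·m) − ½ ≤ τ_int(g)` for every measurable balanced sign observable `g` of the exact
  sampler, `exp((d·#sites/4)·m) ≤ 1/κ`.
* §2 **`wilson_kl_arHybrid_ge_dim_mul_card_site_mul_ballLog_of_floor`** (unitary `ρ`, `N ≥ 1`, `ε > 0`) —
  with `m = (1 − 2N(1 − w)/ε²)·log(1/φ_ρ(ε)) − log 2 ≥ 0` for any common plaquette floor
  `w ≤ ⟨(1/N)Re tr U_p⟩_β`: `(d·#sites/4)·m ≤ KL`.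

NOT CLAIMED: explicit small-ball masses `φ_ρ(ε)` (group-specific inputs — an upper bound is what §2 needs);
the sharp constant `dim G/2` of the logarithm; conditioners reading both endpoints.  No `def`, no `sorry`,
nothing cited as a fact beyond the tree.
-/

noncomputable section

namespace Summit.Ventures.LatticeQCDFlow.Theory2.Autoregressive

open MeasureTheory Function Set
open Literature.MathematicalPhysics.QuantumFieldTheory Literature.MathematicalPhysics.QuantumLattice
open Summit.Ventures.LatticeQCDFlow.Exactness Summit.Ventures.LatticeQCDFlow.Scoring
open scoped Matrix Matrix.Norms.Frobenius

section Wilson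

variable {d L N : ℕ} {G : Type*} [Group G] [TopologicalSpace G] [IsTopologicalGroup G]
  [CompactSpace G] [SecondCountableTopology G] [MeasurableSpace G] [BorelSpace G] [NeZero L]
  (ρ : G →* Matrix (Fin N) (Fin N) ℂ)

/-! ## §0 The logarithmic floor as a per-link divergence floor -/

/-- **The logarithmic step floor in the shape the volume law wants.**  Continuous `ρ`, `L ≥ 2`, any `β`;
`B ⊆ G` measurable with `Haar(B) > 0`; `m ≤ log(1/Haar B)·(1/Z)∫𝟙_B(U_p)F dπ − log 2`; `e` a link of `p`,
`s` a set of links off `p`; `q` squeezed, normalised in `e`, not reading `s`, blind to the other links at an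
endpoint `y` of `e`.  Then `m·Z ≤ ∫ F·log(A_sF/(q·A_{insert e s}F)) dπ`. [ours] -/
theorem wilson_stepKL_ge_floor_mul_of_ballLog (hρ : Continuous ρ) (hL : 2 ≤ L) (β : ℝ)
    {B : Set G} (hBm : MeasurableSet B) (hB0 : 0 < (haarProbability G).real B)
    (p : Plaquette d L) {m : ℝ}
    (hmp : m ≤ Real.log (1 / (haarProbability G).real B) *
        ((∫ U, B.indicator (1 : G → ℝ) (plaquetteHolonomy U p.1 p.2.1.1 p.2.1.2) *
            Real.exp (-β * wilsonAction ρ U) ∂Measure.pi (fun _ : Edge d L => haarProbability G)) /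
          (∫ W, Real.exp (-β * wilsonAction ρ W) ∂Measure.pi (fun _ : Edge d L => haarProbability G))) -
        Real.log 2)
    {e : Edge d L}
    (he : e ∈ ({(p.1, p.2.1.1), (p.1.shift p.2.1.1, p.2.1.2), (p.1.shift p.2.1.2, p.2.1.1), (p.1, p.2.1.2)} :
      Finset (Edge d L)))
    {s : Finset (Edge d L)}
    (hs : s ⊆ Finset.univ \
      {(p.1, p.2.1.1), (p.1.shift p.2.1.1, p.2.1.2), (p.1.shift p.2.1.2, p.2.1.1), (p.1, p.2.1.2)})
    {q : GaugeConfig d L G → ℝ} (hqm : Measurable q) {cq Cq : ℝ} (hcq : 0 < cq) (hqlo : ∀ U, cq ≤ q U)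
    (hqhi : ∀ U, q U ≤ Cq) (hq1 : ∀ U, ∫ v, q (update U e v) ∂(haarProbability G) = 1)
    (hqs : ∀ U V, q (s.piecewise V U) = q U)
    {y : Site d L} (hy : e.1 = y ∨ e.1.shift e.2 = y)
    (hqB : ∀ e' : Edge d L, e'.1 = y ∨ e'.1.shift e'.2 = y → e' ≠ e →
      ∀ (U : GaugeConfig d L G) (v : G), q (update U e' v) = q U) :
    m * (∫ W, Real.exp (-β * wilsonAction ρ W) ∂Measure.pi (fun _ : Edge d L => haarProbability G)) ≤
      ∫ U, Real.exp (-β * wilsonAction ρ U) *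
          Real.log (coordAvg (haarProbability G) s (fun V : GaugeConfig d L G => Real.exp (-β * wilsonAction ρ V)) U /
            (q U * coordAvg (haarProbability G) (insert e s)
              (fun V : GaugeConfig d L G => Real.exp (-β * wilsonAction ρ V)) U))
        ∂Measure.pi (fun _ : Edge d L => haarProbability G) := by
  set π := Measure.pi (fun _ : Edge d L => haarProbability G) with hπ
  set Z : ℝ := ∫ W, Real.exp (-β * wilsonAction ρ W) ∂π with hZ
  set Y : ℝ := ∫ U, B.indicator (1 : G → ℝ) (plaquetteHolonomy U p.1 p.2.1.1 p.2.1.2) *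
      Real.exp (-β * wilsonAction ρ U) ∂π with hY
  have hZpos : 0 < Z :=
    integral_exp_pos (Literature.Probability.LatticeModels.integrable_of_continuous_compactSpace _
      (Real.continuous_exp.comp (continuous_const.mul (continuous_wilsonAction ρ hρ))))
  have hstep := wilson_stepKL_ge_ballMass_mul_log (d := d) (L := L) ρ hρ hL β p he hs hBm hB0 hqm hcq hqlo
    hqhi hq1 hqs hy hqB
  -- `m·Z ≤ (log(1/Haar B)·Y/Z − log 2)·Z = log(1/Haar B)·Y − log 2·Z`
  have h1 : m * Z ≤ (Real.log (1 / (haarProbability G).real B) * (Y / Z) - Real.log 2) * Z :=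
    mul_le_mul_of_nonneg_right hmp hZpos.le
  have e1 : (Real.log (1 / (haarProbability G).real B) * (Y / Z) - Real.log 2) * Z =
      Real.log (1 / (haarProbability G).real B) * Y - Real.log 2 * Z := by
    field_simp
  rw [e1] at h1
  exact h1.trans hstep

/-! ## §1 The volume law with the logarithmic rate -/

/-- **THE VOLUME LAW FOR THE TRAINING LOSS, LOGARITHMIC RATE.**  `d ≥ 2`, `L ≥ 2`, continuous `ρ`, any
`β`; `B ⊆ G` measurable with `Haar(B) > 0`; `0 ≤ m ≤ log(1/Haar B)·(1/Z)∫𝟙_B(U_p)F dπ − log 2` for every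
plaquette `p`; squeezed normalised conditionals, `l` a duplicate-free list of ALL links (any order), `q_a`
not reading later links, every `q_e` blind to the other links at an endpoint `Y e` of `e`.  Then
`(d·#sites/4)·m ≤ KL(e^{−βS_W}/Z ‖ H_l)`. [ours] -/
theorem wilson_kl_arHybrid_ge_dim_mul_card_site_mul_ballLog (hd : 2 ≤ d) (hρ : Continuous ρ)
    (hL : 2 ≤ L) (β : ℝ) {B : Set G} (hBm : MeasurableSet B) (hB0 : 0 < (haarProbability G).real B)
    {m : ℝ} (hm0 : 0 ≤ m)
    (hmB : ∀ p : Plaquette d L, m ≤ Real.log (1 / (haarProbability G).real B) *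
        ((∫ U, B.indicator (1 : G → ℝ) (plaquetteHolonomy U p.1 p.2.1.1 p.2.1.2) *
            Real.exp (-β * wilsonAction ρ U) ∂Measure.pi (fun _ : Edge d L => haarProbability G)) /
          (∫ W, Real.exp (-β * wilsonAction ρ W) ∂Measure.pi (fun _ : Edge d L => haarProbability G))) -
        Real.log 2)
    {q : Edge d L → GaugeConfig d L G → ℝ} (hqm : ∀ a, Measurable (q a)) {cq Cq : ℝ} (hcq : 0 < cq)
    (hqlo : ∀ a U, cq ≤ q a U) (hqhi : ∀ a U, q a U ≤ Cq)
    (hq1 : ∀ a U, ∫ v, q a (update U a v) ∂(haarProbability G) = 1)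
    (l : List (Edge d L)) (hl : l.Nodup) (hall : ∀ e : Edge d L, e ∈ l)
    (hpw : l.Pairwise (fun a b => ∀ (U : GaugeConfig d L G) (v : G), q a (update U b v) = q a U))
    (Y : Edge d L → Site d L) (hY : ∀ e : Edge d L, e.1 = Y e ∨ e.1.shift e.2 = Y e)
    (hqB : ∀ e e' : Edge d L, e'.1 = Y e ∨ e'.1.shift e'.2 = Y e → e' ≠ e →
      ∀ (U : GaugeConfig d L G) (v : G), q e (update U e' v) = q e U) :
    (d : ℝ) * Fintype.card (Site d L) / 4 * m ≤
      ∫ U, Real.exp (-β * wilsonAction ρ U) /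
            (∫ W, Real.exp (-β * wilsonAction ρ W) ∂Measure.pi (fun _ : Edge d L => haarProbability G)) *
          Real.log ((Real.exp (-β * wilsonAction ρ U) /
              ∫ W, Real.exp (-β * wilsonAction ρ W) ∂Measure.pi (fun _ : Edge d L => haarProbability G)) /
            ((l.map fun b => q b U).prod *
                coordAvg (haarProbability G) l.toFinset
                  (fun V : GaugeConfig d L G => Real.exp (-β * wilsonAction ρ V)) U /
              ∫ W, Real.exp (-β * wilsonAction ρ W) ∂Measure.pi (fun _ : Edge d L => haarProbability G)))
        ∂Measure.pi (fun _ : Edge d L => haarProbability G) := by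
  exact wilson_kl_arHybrid_ge_dim_mul_card_site_mul_of_stepKL (d := d) (L := L) ρ hd hρ β hqm hcq hqlo hqhi
    hq1 l hl hall hpw hm0 (fun p e he s hs hqs =>
      wilson_stepKL_ge_floor_mul_of_ballLog (d := d) (L := L) ρ hρ hL β hBm hB0 p (hmB p) he hs (hqm e) hcq
        (hqlo e) (hqhi e) (hq1 e) hqs (hY e) (hqB e))

/-- **`τ_int(g) ≥ exp((d·#sites/4)·m) − ½`** for every measurable balanced sign observable `g` of the exact
independence sampler, under the hypotheses of `wilson_kl_arHybrid_ge_dim_mul_card_site_mul_ballLog`. [ours] -/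
theorem wilson_tauInt_sign_ge_exp_ballLog (hd : 2 ≤ d) (hρ : Continuous ρ)
    (hL : 2 ≤ L) (β : ℝ) {B : Set G} (hBm : MeasurableSet B) (hB0 : 0 < (haarProbability G).real B)
    {m : ℝ} (hm0 : 0 ≤ m)
    (hmB : ∀ p : Plaquette d L, m ≤ Real.log (1 / (haarProbability G).real B) *
        ((∫ U, B.indicator (1 : G → ℝ) (plaquetteHolonomy U p.1 p.2.1.1 p.2.1.2) *
            Real.exp (-β * wilsonAction ρ U) ∂Measure.pi (fun _ : Edge d L => haarProbability G)) /
          (∫ W, Real.exp (-β * wilsonAction ρ W) ∂Measure.pi (fun _ : Edge d L => haarProbability G))) -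
        Real.log 2)
    {q : Edge d L → GaugeConfig d L G → ℝ} (hqm : ∀ a, Measurable (q a)) {cq Cq : ℝ} (hcq : 0 < cq)
    (hqlo : ∀ a U, cq ≤ q a U) (hqhi : ∀ a U, q a U ≤ Cq)
    (hq1 : ∀ a U, ∫ v, q a (update U a v) ∂(haarProbability G) = 1)
    (l : List (Edge d L)) (hl : l.Nodup) (hall : ∀ e : Edge d L, e ∈ l)
    (hpw : l.Pairwise (fun a b => ∀ (U : GaugeConfig d L G) (v : G), q a (update U b v) = q a U))
    (Y : Edge d L → Site d L) (hY : ∀ e : Edge d L, e.1 = Y e ∨ e.1.shift e.2 = Y e)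
    (hqB : ∀ e e' : Edge d L, e'.1 = Y e ∨ e'.1.shift e'.2 = Y e → e' ≠ e →
      ∀ (U : GaugeConfig d L G) (v : G), q e (update U e' v) = q e U)
    {g : GaugeConfig d L G → ℝ} (hgm : Measurable g) (hg1 : ∀ U, g U ^ 2 = 1)
    (hg0 : ∫ U, g U * Real.exp (-β * wilsonAction ρ U) ∂Measure.pi (fun _ : Edge d L => haarProbability G) = 0) :
    Real.exp ((d : ℝ) * Fintype.card (Site d L) / 4 * m) - 1 / 2 ≤
      tauInt (fun k => (∫ U, g U * ((imhOp (Measure.pi fun _ : Edge d L => haarProbability G)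
          (fun V : GaugeConfig d L G => Real.exp (-β * wilsonAction ρ V))
          (fun V : GaugeConfig d L G => (l.map fun b => q b V).prod *
              coordAvg (haarProbability G) l.toFinset
                (fun V' : GaugeConfig d L G => Real.exp (-β * wilsonAction ρ V')) V /
            ∫ W, Real.exp (-β * wilsonAction ρ W) ∂Measure.pi (fun _ : Edge d L => haarProbability G)))^[k]
            g) U * Real.exp (-β * wilsonAction ρ U) ∂Measure.pi (fun _ : Edge d L => haarProbability G)) /
          ∫ U, g U ^ 2 * Real.exp (-β * wilsonAction ρ U) ∂Measure.pi (fun _ : Edge d L => haarProbability G)) := by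
  exact wilson_tauInt_sign_ge_exp_of_stepKL (d := d) (L := L) ρ hd hρ β hqm hcq hqlo hqhi hq1 l hl hall hpw hm0
    (fun p e he s hs hqs =>
      wilson_stepKL_ge_floor_mul_of_ballLog (d := d) (L := L) ρ hρ hL β hBm hB0 p (hmB p) he hs (hqm e) hcq
        (hqlo e) (hqhi e) (hq1 e) hqs (hY e) (hqB e)) hgm hg1 hg0

/-- **`1/κ ≥ exp((d·#sites/4)·m)`** — Kish fraction `≤ exp(−(d·#sites/4)·m)`. [ours] -/
theorem wilson_invKish_ge_exp_ballLog (hd : 2 ≤ d) (hρ : Continuous ρ)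
    (hL : 2 ≤ L) (β : ℝ) {B : Set G} (hBm : MeasurableSet B) (hB0 : 0 < (haarProbability G).real B)
    {m : ℝ} (hm0 : 0 ≤ m)
    (hmB : ∀ p : Plaquette d L, m ≤ Real.log (1 / (haarProbability G).real B) *
        ((∫ U, B.indicator (1 : G → ℝ) (plaquetteHolonomy U p.1 p.2.1.1 p.2.1.2) *
            Real.exp (-β * wilsonAction ρ U) ∂Measure.pi (fun _ : Edge d L => haarProbability G)) /
          (∫ W, Real.exp (-β * wilsonAction ρ W) ∂Measure.pi (fun _ : Edge d L => haarProbability G))) -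
        Real.log 2)
    {q : Edge d L → GaugeConfig d L G → ℝ} (hqm : ∀ a, Measurable (q a)) {cq Cq : ℝ} (hcq : 0 < cq)
    (hqlo : ∀ a U, cq ≤ q a U) (hqhi : ∀ a U, q a U ≤ Cq)
    (hq1 : ∀ a U, ∫ v, q a (update U a v) ∂(haarProbability G) = 1)
    (l : List (Edge d L)) (hl : l.Nodup) (hall : ∀ e : Edge d L, e ∈ l)
    (hpw : l.Pairwise (fun a b => ∀ (U : GaugeConfig d L G) (v : G), q a (update U b v) = q a U))
    (Y : Edge d L → Site d L) (hY : ∀ e : Edge d L, e.1 = Y e ∨ e.1.shift e.2 = Y e)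
    (hqB : ∀ e e' : Edge d L, e'.1 = Y e ∨ e'.1.shift e'.2 = Y e → e' ≠ e →
      ∀ (U : GaugeConfig d L G) (v : G), q e (update U e' v) = q e U) :
    Real.exp ((d : ℝ) * Fintype.card (Site d L) / 4 * m) ≤
      (∫ U, Real.exp (-β * wilsonAction ρ U) /
            ((l.map fun b => q b U).prod *
                coordAvg (haarProbability G) l.toFinset
                  (fun V : GaugeConfig d L G => Real.exp (-β * wilsonAction ρ V)) U /
              ∫ W, Real.exp (-β * wilsonAction ρ W) ∂Measure.pi (fun _ : Edge d L => haarProbability G)) *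
          Real.exp (-β * wilsonAction ρ U) ∂Measure.pi (fun _ : Edge d L => haarProbability G)) /
        (∫ W, Real.exp (-β * wilsonAction ρ W) ∂Measure.pi (fun _ : Edge d L => haarProbability G)) ^ 2 := by
  exact wilson_invKish_ge_exp_of_stepKL (d := d) (L := L) ρ hd hρ β hqm hcq hqlo hqhi hq1 l hl hall hpw hm0
    (fun p e he s hs hqs =>
      wilson_stepKL_ge_floor_mul_of_ballLog (d := d) (L := L) ρ hρ hL β hBm hB0 p (hmB p) he hs (hqm e) hcq
        (hqlo e) (hqhi e) (hq1 e) hqs (hY e) (hqB e))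

/-! ## §2 From a plaquette floor, by Chebyshev -/

/-- **The logarithmic volume law from a plaquette floor** (unitary `ρ`, `N ≥ 1`, `ε > 0`): with
`w ≤ ⟨(1/N)Re tr U_p⟩_β` for every plaquette and `m = (1 − 2N(1 − w)/ε²)·log(1/φ_ρ(ε)) − log 2 ≥ 0`
(`φ_ρ(ε) = Haar{‖ρ(g) − 1‖ ≤ ε} > 0`): `(d·#sites/4)·m ≤ KL(e^{−βS_W}/Z ‖ H_l)`. [ours] -/
theorem wilson_kl_arHybrid_ge_dim_mul_card_site_mul_ballLog_of_floor (hd : 2 ≤ d) (hN : 1 ≤ N)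
    (hρ : Continuous ρ) (hρU : ∀ g, ρ g ∈ Matrix.unitaryGroup (Fin N) ℂ) (hL : 2 ≤ L) (β : ℝ)
    {ε : ℝ} (hε : 0 < ε) (hφ0 : 0 < (haarProbability G).real {g : G | ‖ρ g - 1‖ ≤ ε}) {w : ℝ}
    (hw : ∀ p : Plaquette d L, w ≤ wilsonExpectation ρ β
      (fun U : GaugeConfig d L G => (N : ℝ)⁻¹ * (ρ (plaquetteHolonomy U p.1 p.2.1.1 p.2.1.2)).trace.re))
    (hm0 : 0 ≤ (1 - 2 * N * (1 - w) / ε ^ 2) * Real.log (1 / (haarProbability G).real {g : G | ‖ρ g - 1‖ ≤ ε}) -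
      Real.log 2)
    {q : Edge d L → GaugeConfig d L G → ℝ} (hqm : ∀ a, Measurable (q a)) {cq Cq : ℝ} (hcq : 0 < cq)
    (hqlo : ∀ a U, cq ≤ q a U) (hqhi : ∀ a U, q a U ≤ Cq)
    (hq1 : ∀ a U, ∫ v, q a (update U a v) ∂(haarProbability G) = 1)
    (l : List (Edge d L)) (hl : l.Nodup) (hall : ∀ e : Edge d L, e ∈ l)
    (hpw : l.Pairwise (fun a b => ∀ (U : GaugeConfig d L G) (v : G), q a (update U b v) = q a U))
    (Y : Edge d L → Site d L) (hY : ∀ e : Edge d L, e.1 = Y e ∨ e.1.shift e.2 = Y e)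
    (hqB : ∀ e e' : Edge d L, e'.1 = Y e ∨ e'.1.shift e'.2 = Y e → e' ≠ e →
      ∀ (U : GaugeConfig d L G) (v : G), q e (update U e' v) = q e U) :
    (d : ℝ) * Fintype.card (Site d L) / 4 *
        ((1 - 2 * N * (1 - w) / ε ^ 2) * Real.log (1 / (haarProbability G).real {g : G | ‖ρ g - 1‖ ≤ ε}) -
          Real.log 2) ≤
      ∫ U, Real.exp (-β * wilsonAction ρ U) /
            (∫ W, Real.exp (-β * wilsonAction ρ W) ∂Measure.pi (fun _ : Edge d L => haarProbability G)) *
          Real.log ((Real.exp (-β * wilsonAction ρ U) /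
              ∫ W, Real.exp (-β * wilsonAction ρ W) ∂Measure.pi (fun _ : Edge d L => haarProbability G)) /
            ((l.map fun b => q b U).prod *
                coordAvg (haarProbability G) l.toFinset
                  (fun V : GaugeConfig d L G => Real.exp (-β * wilsonAction ρ V)) U /
              ∫ W, Real.exp (-β * wilsonAction ρ W) ∂Measure.pi (fun _ : Edge d L => haarProbability G)))
        ∂Measure.pi (fun _ : Edge d L => haarProbability G) := by
  have hlog0 : 0 ≤ Real.log (1 / (haarProbability G).real {g : G | ‖ρ g - 1‖ ≤ ε}) := by
    apply Real.log_nonneg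
    rw [le_div_iff₀ hφ0, one_mul]
    exact measureReal_le_one
  have hBm : MeasurableSet {g : G | ‖ρ g - 1‖ ≤ ε} :=
    (isClosed_le ((hρ.sub continuous_const).norm) continuous_const).measurableSet
  exact wilson_kl_arHybrid_ge_dim_mul_card_site_mul_ballLog (d := d) (L := L) ρ hd hρ hL β
    (B := {g : G | ‖ρ g - 1‖ ≤ ε}) hBm hφ0 hm0
    (fun p => by
      have h := wilson_ball_mass_ge_of_floor (d := d) (L := L) ρ hN hρ hρU β hε p (hw p)
      have := mul_le_mul_of_nonneg_right h hlog0
      linarith)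
    hqm hcq hqlo hqhi hq1 l hl hall hpw Y hY hqB

end Wilson

end Summit.Ventures.LatticeQCDFlow.Theory2.Autoregressive

end
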